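import Summits.CriticalPhenomena.PercolationContinuityZ3.Theorems.PercNearOneGluingNoHeavyRsw3FarVolumeCritical
import Summits.CriticalPhenomena.PercolationContinuityZ3.Theorems.PercNearOneGluingNoHeavyRsw3InnerClusterTransferIIC
import Summits.CriticalPhenomena.PercolationContinuityZ3.Theorems.PercAnnulusCrossingIICAspectExistence
import Summits.CriticalPhenomena.PercolationContinuityZ3.Theorems.PercAnnulusCrossingIICMeasure
import Summits.CriticalPhenomena.PercolationContinuityZ3.Theorems.PercAnnulusCrossingIICVolumeUpper
import Summits.CriticalPhenomena.PercolationContinuityZ3.Theorems.PercNearOneGluingNoHeavyRsw3AnnulusCountTightZ2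
import Summits.CriticalPhenomena.PercolationContinuityZ3.Theorems.PercAnnulusCrossingIICPlanarKesten
import HarnessLib

/-!
# RSW3 lane (P2, gen 20): KESTEN'S THEOREM (8) ON `ℤ^d` UNDER (A2)□ AND TIGHTNESS OF THE CROSSING-CLUSTER COUNT — the incipient
# infinite cluster has `|C ∩ Λ(n)| ≥ λ |Λ(n)| π_{p_c}(n)` with `ν`-probability `≥ c`, and `c·|Λ(n)|π(n) ≤ E_ν|C ∩ Λ(n)| ≤ C·|Λ(n)|π(n)`

builds on p205010 (kernel theorem, internal audit signed; external expert review pending) — used only through the EXISTENCE of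
Kesten's IIC at `p_c(ℤ^d)` under (A2)□ (p1, `kestenIICExistsAt_criticalProbI_of_setToSetQuasiMultAspectAt`, which uses `θ(p_c) = 0`)
in the packaged corollaries; the `ν`-statements are proved for every Kesten-limit measure `ν` without it.

Cell `prim-rsw3`, prover seat `prim-rsw3-p2` (gen 20), memo `run/shared/lean/prim/rsw3/P2-RSWLITE.md` §27.
Support file (`--supports stmt-CriticalPhenomena-4575`); no definitions, no named facts, no sorries.

The LOWER half of the IIC volume law (memo V73), from the bounded-ratio statement B(C) of `…Rsw3FarVolumeCritical` and gen 19's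
inner-cluster transfer inequality `ν(F) ≥ ϰ · P(F ∩ A_{sm})/π(sm)` (`le_iicMeasure_real_of_innerCluster`).  Hypotheses: `p_c(ℤ^d)`,
`d ≥ 2`, (A2)□ at aspect `(s,L)` (`2 ≤ s ≤ L`, `ϰ > 0`), tightness of `N(n,Cn) = Crossing.annulusClusterCount d n (Cn)` at ONE aspect `C ≥ 2`
(at `C = 2` in `d = 3`: `Crossing.AnnulusClusterCountTight`, or X_B; at any `C`: a uniform annulus-blocking bound), `ν` a measure with
Kesten's IIC limit property at `p_c`.

* **`le_iicMeasure_real_fat`** — `∃ λ c > 0 ∀ a ≥ 1: c ≤ ν{λ(2a+1)^dπ(a) ≤ #{z ∈ Λ(Ca) : 0 ↔ z in Λ(4Ca)}}`;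
* **`le_iicMeasure_real_volume_ge`** — `∃ λ c > 0 ∀ n ≥ C: c ≤ ν{λ(2n+1)^dπ_{p_c}(n) ≤ #{z ∈ Λ(n) : 0 ↔ z}}` (the IIC is FAT at every scale);
* **`le_iicMeasure_sum_openConn`** — `∃ c > 0 ∀ n ≥ C: c·(2n+1)^d π_{p_c}(n) ≤ Σ_{z ∈ Λ(n)} ν(0 ↔ z) = E_ν|C ∩ Λ(n)|` (`ν` finite) — with p1 gen 7's
  upper bound `iicMeasure_sum_openConn_le_criticalProbI` this is KESTEN'S (8) `E_ν|C ∩ Λ(n)| ≍ |Λ(n)|π(n)` on `ℤ^d`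
  (**`exists_iicMeasure_sum_openConn_two_sided`**, packaged with existence);
* **`le_iicMeasure_real_volume_two_sided`** — `∃ λ c > 0 ∀ n ≥ C: c ≤ ν{λ s(n) ≤ |C∩Λ(n)| ≤ s(n)/λ}` (two-sided tightness in probability);
* **`exists_iicMeasure_volume_of_boxCrossing_le`** — the same package from ANY uniform annulus-blocking bound `P_{p_c}(Λ(n)↔∂ⁱⁿΛ(Cn)) ≤ 1−δ`;
* `exists_iicMeasure_volume_Z3_of_annulusClusterCountTight`, `exists_iicMeasure_volume_Z3_of_critAnnulusNonCrossing` — `ℤ³` instances;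
* **`exists_iicMeasure_volume_Z2`** — the `ℤ²` instance, UNCONDITIONAL (planar (A2)□ from RSW, p1 gen 6; planar count tightness from closed dual
  circuits, `…Rsw3AnnulusCountTightZ2`): Kesten's (8) with the lower tail for the planar IIC.

Honest placement: Kesten 1986 Thm. (8) proves `E_ν|C ∩ Λ(n)| ≍ n²π(n)` on `ℤ²` (RSW); Cai–Ding 2024 (arXiv:2412.05709, Cor. 1.5) prove
the analogue for the metric-graph GFF in `3 ≤ d ≤ 5`; for Bernoulli percolation on `ℤ^d`, `3 ≤ d ≤ 6`, both hypotheses used here are open.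

References: H. Kesten, Probab. Theory Relat. Fields 73 (1986) 369–394, Thm. (8) [Kesten1986]; D. Basu, A. Sapozhnikov, ECP 22
(2017), Thm. 1.1 [BasuSapozhnikov2017ECP]; C. Borgs, J. Chayes, H. Kesten, J. Spencer, Comm. Math. Phys. 224 (2001)
[BorgsChayesKestenSpencer2001]; Z. Cai, J. Ding, arXiv:2412.05709 (2024). [folklore]
-/

noncomputable section

namespace Summit.CriticalPhenomena.PercolationContinuityZ3.Theorems

namespace Rsw3

open MeasureTheory Filter Topology Literature.Probability.LatticeModels Literature.Probability.Percolation
open SurfaceTension Crossing SimpleGraph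
open scoped Literature.Probability.Percolation

variable {d : ℕ}

/-! ## The IIC is fat at scale `2a`, certified inside `Λ(8a)` -/

open Classical in
/-- **THE IIC IS FAT AT THE IIC SCALE** (`p_c(ℤ^d)`, `d ≥ 2`; (A2)□ `(s,L,ϰ)`, `2 ≤ s ≤ L`, `ϰ > 0`; tightness of `N(n,2n)`; `ν` any measure
with Kesten's IIC limit property; tightness of `N(n,Cn)` at one `C ≥ 2`): **`∃ λ c > 0, ∀ a ≥ 1: c ≤ ν{λ(2a+1)^d π_{p_c}(a) ≤ #{z ∈ Λ(Ca) : 0 ↔ z in Λ(4Ca)}}`**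
— B(C) (`exists_le_real_siteToBoundary_inter_fat_of_setToSetQuasiMultAspectAt`) transferred to `ν` by the inner-cluster inequality
`ν(F) ≥ ϰ P(F ∩ A_{sm})/π(sm)`, `m = 4Ca+1` (the fat event depends only on the cluster of `0` inside `Λ(4Ca)`).
[cite: Kesten1986, Thm. (8)] [cite: BasuSapozhnikov2017ECP, Thm. 1.1] -/
theorem le_iicMeasure_real_fat (hd : 2 ≤ d) {s L : ℕ} (hs : 2 ≤ s) (hsL : s ≤ L) {ϰ : ℝ} (hϰ : 0 < ϰ)
    (h : SetToSetQuasiMultAspectAt d (criticalProbI d) s L ϰ) {C : ℕ} (hC : 2 ≤ C)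
    (hT : ∀ ε : ℝ, 0 < ε → ∃ k : ℕ, ∀ n : ℕ, 1 ≤ n →
      (bondPercolation (zdGraph d) (criticalProbI d)).real {ω | (k : ℕ∞) < annulusClusterCount d n (C * n) ω} ≤ ε)
    {ν : Measure (BondConfig (Site d))}
    (hν : ∀ (K : Finset (Sym2 (Site d))) (E : Set (BondConfig (Site d))), MeasurableSet E → DeterminedBy E ↑K →
      Tendsto (fun n : ℕ => (bondPercolation (zdGraph d) (criticalProbI d)).real (E ∩ siteToBoundary d n) /
        oneArmProb d (criticalProbI d) n) atTop (𝓝 (ν.real E))) :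
    ∃ lam c : ℝ, 0 < lam ∧ 0 < c ∧ ∀ a : ℕ, 1 ≤ a →
      c ≤ ν.real {ω : BondConfig (Site d) | lam * (2 * (a : ℝ) + 1) ^ d * oneArmProb d (criticalProbI d) a ≤
        (((box d (C * a)).filter fun w =>
          ω ∈ (openConnIn (↑(box d (4 * (C * a))) : Set (Site d)) (0 : Site d) w : Set (BondConfig (Site d)))).card : ℝ)} := by
  classical
  have hd1 : 1 ≤ d := by omega
  set p := criticalProbI d with hp
  set μ := bondPercolation (zdGraph d) p with hμ
  have hpc : 0 < ((criticalProbI d : unitInterval) : ℝ) := by rw [coe_criticalProbI]; exact criticalProb_zd_pos d hd1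
  have hπpos : ∀ n : ℕ, 0 < oneArmProb d p n := fun n =>
    (pow_pos hpc n).trans_le (DKT20.pow_le_real_siteToBoundary hd1 p n)
  obtain ⟨lam, c, hlam, hc, hB⟩ := exists_le_real_siteToBoundary_inter_fat_of_setToSetQuasiMultAspectAt hd hs hsL hϰ h hC hT
  refine ⟨lam, ϰ * c, hlam, mul_pos hϰ hc, fun a ha => ?_⟩
  set F : Set (BondConfig (Site d)) := {ω : BondConfig (Site d) | lam * (2 * (a : ℝ) + 1) ^ d * oneArmProb d p a ≤
      (((box d (C * a)).filter fun w =>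
        ω ∈ (openConnIn (↑(box d (4 * (C * a))) : Set (Site d)) (0 : Site d) w : Set (BondConfig (Site d)))).card : ℝ)} with hF
  -- `F` is local and depends only on the cluster of `0` inside `Λ(4Ca)`
  have hdet : DeterminedBy F (↑((box d (4 * (C * a))).sym2) : Set (Sym2 (Site d))) :=
    determinedBy_setOf_le_card_filter _ _ (fun w _ =>
      DCT16.determinedBy_openConnIn (↑(box d (4 * (C * a)))) (0 : Site d) w (K := ↑(box d (4 * (C * a))).sym2)
        (by rw [Finset.coe_sym2])) _
  have hinner : ∀ ω ω' : BondConfig (Site d),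
      DCT16.clusterSet (box d (4 * (C * a) + 1 - 1)) ω = DCT16.clusterSet (box d (4 * (C * a) + 1 - 1)) ω' → (ω ∈ F ↔ ω' ∈ F) := by
    intro ω ω' hCl
    rw [Nat.add_sub_cancel] at hCl
    have hfilter : ((box d (C * a)).filter fun w =>
        ω ∈ (openConnIn (↑(box d (4 * (C * a))) : Set (Site d)) (0 : Site d) w : Set (BondConfig (Site d)))) =
        (box d (C * a)).filter fun w =>
          ω' ∈ (openConnIn (↑(box d (4 * (C * a))) : Set (Site d)) (0 : Site d) w : Set (BondConfig (Site d))) := by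
      refine Finset.filter_congr fun w _ => ?_
      change w ∈ DCT16.clusterSet (box d (4 * (C * a))) ω ↔ w ∈ DCT16.clusterSet (box d (4 * (C * a))) ω'
      rw [hCl]
    simp only [hF, Set.mem_setOf_eq, hfilter]
  -- the transfer inequality
  have hCa : 1 ≤ C * a := le_trans ha (Nat.le_mul_of_pos_left a (by omega))
  have htr := le_iicMeasure_real_of_innerCluster hd1 p hpc h hϰ.le (by omega : 1 ≤ s) hsL (m := 4 * (C * a) + 1) (by omega)
    hν _ hdet hinner
  have hB' := hB a ha
  rw [Set.inter_comm] at hB'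
  have hπ := hπpos (s * (4 * (C * a) + 1))
  calc ϰ * c ≤ ϰ * (μ.real (F ∩ siteToBoundary d (s * (4 * (C * a) + 1))) / oneArmProb d p (s * (4 * (C * a) + 1))) := by
        refine mul_le_mul_of_nonneg_left ?_ hϰ.le
        rw [le_div_iff₀ hπ]
        exact hB'
    _ ≤ ν.real F := htr

/-! ## The IIC is fat at every scale; the mean volume -/

open Classical in
/-- **THE IIC IS FAT AT EVERY SCALE** (`p_c(ℤ^d)`, `d ≥ 2`; (A2)□; tightness of `N(n,Cn)` at one `C ≥ 2`; `ν` a finite Kesten-limit measure):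
**`∃ λ c > 0, ∀ n ≥ C: c ≤ ν{λ (2n+1)^d π_{p_c}(n) ≤ #{z ∈ Λ(n) : 0 ↔ z}}`** — Kesten's (8) with the lower tail: `|C ∩ Λ(n)|` is at least a
fixed fraction of `|Λ(n)|π(n)` with `ν`-probability bounded below (from `le_iicMeasure_real_fat` at `a = ⌊n/C⌋`,
`(2n+1)^dπ(n) ≤ (2C)^d(2a+1)^dπ(a)`). [cite: Kesten1986, Thm. (8)] [cite: BasuSapozhnikov2017ECP, Thm. 1.1] -/
theorem le_iicMeasure_real_volume_ge (hd : 2 ≤ d) {s L : ℕ} (hs : 2 ≤ s) (hsL : s ≤ L) {ϰ : ℝ} (hϰ : 0 < ϰ)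
    (h : SetToSetQuasiMultAspectAt d (criticalProbI d) s L ϰ) {C : ℕ} (hC : 2 ≤ C)
    (hT : ∀ ε : ℝ, 0 < ε → ∃ k : ℕ, ∀ n : ℕ, 1 ≤ n →
      (bondPercolation (zdGraph d) (criticalProbI d)).real {ω | (k : ℕ∞) < annulusClusterCount d n (C * n) ω} ≤ ε)
    {ν : Measure (BondConfig (Site d))} [IsFiniteMeasure ν]
    (hν : ∀ (K : Finset (Sym2 (Site d))) (E : Set (BondConfig (Site d))), MeasurableSet E → DeterminedBy E ↑K →
      Tendsto (fun n : ℕ => (bondPercolation (zdGraph d) (criticalProbI d)).real (E ∩ siteToBoundary d n) /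
        oneArmProb d (criticalProbI d) n) atTop (𝓝 (ν.real E))) :
    ∃ lam c : ℝ, 0 < lam ∧ 0 < c ∧ ∀ n : ℕ, C ≤ n →
      c ≤ ν.real {ω : BondConfig (Site d) | lam * (2 * (n : ℝ) + 1) ^ d * oneArmProb d (criticalProbI d) n ≤
        (((box d n).filter fun z => ω ∈ (openConn (0 : Site d) z : Set (BondConfig (Site d)))).card : ℝ)} := by
  classical
  obtain ⟨lam, c, hlam, hc, hfat⟩ := le_iicMeasure_real_fat hd hs hsL hϰ h hC hT hν
  have hC0 : (0 : ℝ) < C := by exact_mod_cast (by omega : 0 < C)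
  refine ⟨lam / (2 * (C : ℝ)) ^ d, c, by positivity, hc, fun n hn => ?_⟩
  obtain ⟨a, ha⟩ : ∃ a : ℕ, a = n / C := ⟨_, rfl⟩
  have hC1 : 0 < C := by omega
  have ha1 : 1 ≤ a := by rw [ha]; exact (Nat.le_div_iff_mul_le hC1).2 (by simpa using hn)
  have han : C * a ≤ n := by rw [ha, mul_comm]; exact Nat.div_mul_le_self n C
  have hna : n < C * (a + 1) := by
    rw [ha, Nat.mul_add, Nat.mul_one, mul_comm]
    exact Nat.lt_div_mul_add hC1
  have haa : a ≤ n := le_trans (Nat.le_mul_of_pos_left a hC1) han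
  refine (hfat a ha1).trans (measureReal_mono fun ω hω => ?_)
  rw [Set.mem_setOf_eq] at hω ⊢
  have hπ : oneArmProb d (criticalProbI d) n ≤ oneArmProb d (criticalProbI d) a :=
    DCT16.real_siteToBoundary_antitone _ haa
  have hπ0 : 0 ≤ oneArmProb d (criticalProbI d) n := measureReal_nonneg
  have h3 : (2 * (n : ℝ) + 1) ^ d ≤ (2 * (C : ℝ)) ^ d * (2 * (a : ℝ) + 1) ^ d := by
    rw [← mul_pow]
    refine pow_le_pow_left₀ (by positivity) ?_ _
    have : (n : ℝ) + 1 ≤ C * (a + 1) := by exact_mod_cast hna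
    have hC1' : (1 : ℝ) ≤ C := by exact_mod_cast hC1
    nlinarith
  have hcard : (((box d (C * a)).filter fun w =>
        ω ∈ (openConnIn (↑(box d (4 * (C * a))) : Set (Site d)) (0 : Site d) w : Set (BondConfig (Site d)))).card : ℝ) ≤
      (((box d n).filter fun z => ω ∈ (openConn (0 : Site d) z : Set (BondConfig (Site d)))).card : ℝ) := by
    exact_mod_cast Finset.card_le_card fun z hz => by
      obtain ⟨hzb, hzc⟩ := Finset.mem_filter.1 hz
      refine Finset.mem_filter.2 ⟨box_mono d han hzb, ?_⟩
      obtain ⟨h0, hz', hr⟩ := hzc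
      exact hr.map (SimpleGraph.Embedding.induce _).toHom
  calc lam / (2 * (C : ℝ)) ^ d * (2 * (n : ℝ) + 1) ^ d * oneArmProb d (criticalProbI d) n
      ≤ lam / (2 * (C : ℝ)) ^ d * ((2 * (C : ℝ)) ^ d * (2 * (a : ℝ) + 1) ^ d) * oneArmProb d (criticalProbI d) a :=
        mul_le_mul (mul_le_mul_of_nonneg_left h3 (by positivity)) hπ hπ0 (by positivity)
    _ = lam * (2 * (a : ℝ) + 1) ^ d * oneArmProb d (criticalProbI d) a := by field_simp
    _ ≤ _ := hω
    _ ≤ _ := hcard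

open Classical in
/-- **THE MEAN VOLUME OF THE IIC IS AT LEAST `c |Λ(n)| π_{p_c}(n)`** (`p_c(ℤ^d)`, `d ≥ 2`; (A2)□; tightness of `N(n,Cn)`; `ν` a finite
Kesten-limit measure): **`∃ c > 0, ∀ n ≥ C: c · (2n+1)^d · π_{p_c}(n) ≤ Σ_{z ∈ Λ(n)} ν(0 ↔ z)`** (`= E_ν|C(0) ∩ Λ(n)|`) — Markov for
counts on `le_iicMeasure_real_volume_ge`.  The matching UPPER bound `≤ C n^d π(n)` is p1's `iicMeasure_sum_openConn_le_criticalProbI`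
(from (A2)□ alone). [cite: Kesten1986, Thm. (8)] -/
theorem le_iicMeasure_sum_openConn (hd : 2 ≤ d) {s L : ℕ} (hs : 2 ≤ s) (hsL : s ≤ L) {ϰ : ℝ} (hϰ : 0 < ϰ)
    (h : SetToSetQuasiMultAspectAt d (criticalProbI d) s L ϰ) {C : ℕ} (hC : 2 ≤ C)
    (hT : ∀ ε : ℝ, 0 < ε → ∃ k : ℕ, ∀ n : ℕ, 1 ≤ n →
      (bondPercolation (zdGraph d) (criticalProbI d)).real {ω | (k : ℕ∞) < annulusClusterCount d n (C * n) ω} ≤ ε)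
    {ν : Measure (BondConfig (Site d))} [IsFiniteMeasure ν]
    (hν : ∀ (K : Finset (Sym2 (Site d))) (E : Set (BondConfig (Site d))), MeasurableSet E → DeterminedBy E ↑K →
      Tendsto (fun n : ℕ => (bondPercolation (zdGraph d) (criticalProbI d)).real (E ∩ siteToBoundary d n) /
        oneArmProb d (criticalProbI d) n) atTop (𝓝 (ν.real E))) :
    ∃ c : ℝ, 0 < c ∧ ∀ n : ℕ, C ≤ n →
      c * (2 * (n : ℝ) + 1) ^ d * oneArmProb d (criticalProbI d) n ≤ ∑ z ∈ box d n, ν.real (openConn (0 : Site d) z) := by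
  classical
  obtain ⟨lam, c, hlam, hc, hvol⟩ := le_iicMeasure_real_volume_ge hd hs hsL hϰ h hC hT hν
  refine ⟨lam * c, mul_pos hlam hc, fun n hn => ?_⟩
  have hmarkov := mul_real_le_card_filter_le_sum ν (box d n) (fun z => (openConn (0 : Site d) z : Set (BondConfig (Site d))))
    (fun z _ => measurableSet_openConn_holds (0 : Site d) z) (lam * (2 * (n : ℝ) + 1) ^ d * oneArmProb d (criticalProbI d) n)
  have ht0 : 0 ≤ lam * (2 * (n : ℝ) + 1) ^ d * oneArmProb d (criticalProbI d) n :=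
    mul_nonneg (mul_nonneg hlam.le (by positivity)) measureReal_nonneg
  calc lam * c * (2 * (n : ℝ) + 1) ^ d * oneArmProb d (criticalProbI d) n
      = (lam * (2 * (n : ℝ) + 1) ^ d * oneArmProb d (criticalProbI d) n) * c := by ring
    _ ≤ (lam * (2 * (n : ℝ) + 1) ^ d * oneArmProb d (criticalProbI d) n) *
          ν.real {ω : BondConfig (Site d) | lam * (2 * (n : ℝ) + 1) ^ d * oneArmProb d (criticalProbI d) n ≤
            (((box d n).filter fun z => ω ∈ (openConn (0 : Site d) z : Set (BondConfig (Site d)))).card : ℝ)} :=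
        mul_le_mul_of_nonneg_left (hvol n hn) ht0
    _ ≤ ∑ z ∈ box d n, ν.real (openConn (0 : Site d) z) := hmarkov

/-! ## Packaged with the existence of the IIC: Kesten's (8) on `ℤ^d`, two-sided -/

open Classical in
/-- **KESTEN'S THEOREM (8) ON `ℤ^d`, TWO-SIDED, UNDER (A2)□ AND COUNT TIGHTNESS AT ONE ASPECT `C₀ ≥ 2`** (`p_c(ℤ^d)`, `d ≥ 2`): there is a
probability measure `ν` with Kesten's IIC limit property at `p_c` (it exists under (A2)□, p1) and constants `λ, c, C > 0` with, for all `n ≥ C₀`,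
**`c ≤ ν{λ|Λ(n)|π(n) ≤ |C(0) ∩ Λ(n)|}`** and **`c·(2n+1)^dπ_{p_c}(n) ≤ E_ν|C(0) ∩ Λ(n)| ≤ C·n^dπ_{p_c}(n)`**.  Uses p205010 only through
the IIC existence theorem. [cite: Kesten1986, Thm. (8)] [cite: BasuSapozhnikov2017ECP, Thm. 1.1] -/
theorem exists_iicMeasure_sum_openConn_two_sided (hd : 2 ≤ d) {s L : ℕ} (hs : 2 ≤ s) (hsL : s ≤ L) {ϰ : ℝ} (hϰ : 0 < ϰ)
    (h : SetToSetQuasiMultAspectAt d (criticalProbI d) s L ϰ) {C₀ : ℕ} (hC₀ : 2 ≤ C₀)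
    (hT : ∀ ε : ℝ, 0 < ε → ∃ k : ℕ, ∀ n : ℕ, 1 ≤ n →
      (bondPercolation (zdGraph d) (criticalProbI d)).real {ω | (k : ℕ∞) < annulusClusterCount d n (C₀ * n) ω} ≤ ε) :
    ∃ ν : Measure (BondConfig (Site d)), IsProbabilityMeasure ν ∧
      (∀ (K : Finset (Sym2 (Site d))) (E : Set (BondConfig (Site d))), MeasurableSet E → DeterminedBy E ↑K →
        Tendsto (fun n : ℕ => (bondPercolation (zdGraph d) (criticalProbI d)).real (E ∩ siteToBoundary d n) /
          oneArmProb d (criticalProbI d) n) atTop (𝓝 (ν.real E))) ∧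
      ∃ lam c C : ℝ, 0 < lam ∧ 0 < c ∧ 0 < C ∧ ∀ n : ℕ, C₀ ≤ n →
        c ≤ ν.real {ω : BondConfig (Site d) | lam * (2 * (n : ℝ) + 1) ^ d * oneArmProb d (criticalProbI d) n ≤
          (((box d n).filter fun z => ω ∈ (openConn (0 : Site d) z : Set (BondConfig (Site d)))).card : ℝ)} ∧
        c * (2 * (n : ℝ) + 1) ^ d * oneArmProb d (criticalProbI d) n ≤ ∑ z ∈ box d n, ν.real (openConn (0 : Site d) z) ∧
        ∑ z ∈ box d n, ν.real (openConn (0 : Site d) z) ≤ C * (n : ℝ) ^ d * oneArmProb d (criticalProbI d) n := by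
  have hd1 : 1 ≤ d := by omega
  have hpc : 0 < ((criticalProbI d : unitInterval) : ℝ) := by rw [coe_criticalProbI]; exact criticalProb_zd_pos d hd1
  have hex := kestenIICExistsAt_criticalProbI_of_setToSetQuasiMultAspectAt hd hs hϰ h
  obtain ⟨ν, hνprob, hν⟩ := exists_iicMeasure_of_kestenIICExistsAt hd1 (criticalProbI d) hpc hex
  obtain ⟨lam, c₁, hlam, hc₁, hvol⟩ := le_iicMeasure_real_volume_ge hd hs hsL hϰ h hC₀ hT hν
  obtain ⟨c₂, hc₂, hmean⟩ := le_iicMeasure_sum_openConn hd hs hsL hϰ h hC₀ hT hν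
  obtain ⟨C, hC, hupper⟩ := iicMeasure_sum_openConn_le_criticalProbI hd hs hsL hϰ h
  refine ⟨ν, hνprob, hν, lam, min c₁ c₂, C, hlam, lt_min hc₁ hc₂, hC, fun n hn => ⟨?_, ?_, hupper ν hν n (by omega)⟩⟩
  · exact (min_le_left _ _).trans (hvol n hn)
  · refine le_trans ?_ (hmean n hn)
    have : 0 ≤ (2 * (n : ℝ) + 1) ^ d * oneArmProb d (criticalProbI d) n := mul_nonneg (by positivity) measureReal_nonneg
    nlinarith [min_le_right c₁ c₂, this]

/-! ## Two-sided tightness of the IIC volume in probability; the blocking form of the hypothesis -/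

open Classical in
/-- **THE IIC VOLUME IS TIGHT ON BOTH SIDES, IN PROBABILITY** (`p_c(ℤ^d)`, `d ≥ 2`; (A2)□; tightness of `N(n,Cn)` at one `C ≥ 2`; `ν` a
PROBABILITY measure with Kesten's limit property): **`∃ λ c > 0, ∀ n ≥ C: c ≤ ν{λ(2n+1)^dπ(n) ≤ |C(0)∩Λ(n)| ≤ (2n+1)^dπ(n)/λ}`** — the lower
tail from `le_iicMeasure_real_volume_ge`, the upper tail by Markov on p1 gen 7's mean bound `E_ν|C∩Λ(n)| ≤ C n^dπ(n)`.
[cite: Kesten1986, Thm. (8)] [cite: BorgsChayesKestenSpencer2001, Thm. 1.1 (i)] -/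
theorem le_iicMeasure_real_volume_two_sided (hd : 2 ≤ d) {s L : ℕ} (hs : 2 ≤ s) (hsL : s ≤ L) {ϰ : ℝ} (hϰ : 0 < ϰ)
    (h : SetToSetQuasiMultAspectAt d (criticalProbI d) s L ϰ) {C : ℕ} (hC : 2 ≤ C)
    (hT : ∀ ε : ℝ, 0 < ε → ∃ k : ℕ, ∀ n : ℕ, 1 ≤ n →
      (bondPercolation (zdGraph d) (criticalProbI d)).real {ω | (k : ℕ∞) < annulusClusterCount d n (C * n) ω} ≤ ε)
    {ν : Measure (BondConfig (Site d))} [IsProbabilityMeasure ν]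
    (hν : ∀ (K : Finset (Sym2 (Site d))) (E : Set (BondConfig (Site d))), MeasurableSet E → DeterminedBy E ↑K →
      Tendsto (fun n : ℕ => (bondPercolation (zdGraph d) (criticalProbI d)).real (E ∩ siteToBoundary d n) /
        oneArmProb d (criticalProbI d) n) atTop (𝓝 (ν.real E))) :
    ∃ lam c : ℝ, 0 < lam ∧ 0 < c ∧ ∀ n : ℕ, C ≤ n →
      c ≤ ν.real {ω : BondConfig (Site d) |
        lam * (2 * (n : ℝ) + 1) ^ d * oneArmProb d (criticalProbI d) n ≤
            (((box d n).filter fun z => ω ∈ (openConn (0 : Site d) z : Set (BondConfig (Site d)))).card : ℝ) ∧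
          (((box d n).filter fun z => ω ∈ (openConn (0 : Site d) z : Set (BondConfig (Site d)))).card : ℝ) ≤
            (2 * (n : ℝ) + 1) ^ d * oneArmProb d (criticalProbI d) n / lam} := by
  classical
  obtain ⟨lam, c, hlam, hc, hvol⟩ := le_iicMeasure_real_volume_ge hd hs hsL hϰ h hC hT hν
  obtain ⟨Cup, hCup, hupper⟩ := iicMeasure_sum_openConn_le_criticalProbI hd hs hsL hϰ h
  have hd1 : 1 ≤ d := by omega
  have hpc : 0 < ((criticalProbI d : unitInterval) : ℝ) := by rw [coe_criticalProbI]; exact criticalProb_zd_pos d hd1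
  have hlam'pos : 0 < min lam (c / (4 * Cup)) := lt_min hlam (by positivity)
  refine ⟨min lam (c / (4 * Cup)), c / 2, hlam'pos, by linarith, fun n hn => ?_⟩
  set lam' : ℝ := min lam (c / (4 * Cup)) with hlam'
  have hlam'le : lam' ≤ lam := min_le_left _ _
  have hlam'le' : lam' ≤ c / (4 * Cup) := min_le_right _ _
  have hn1 : 1 ≤ n := le_trans (by omega) hn
  have hn0 : (0 : ℝ) < n := by exact_mod_cast hn1
  have hπpos : 0 < oneArmProb d (criticalProbI d) n :=
    (pow_pos hpc n).trans_le (DKT20.pow_le_real_siteToBoundary hd1 _ n)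
  set πn := oneArmProb d (criticalProbI d) n with hπn
  set S : ℝ := (2 * (n : ℝ) + 1) ^ d with hSdef
  have hSpos : 0 < S := by positivity
  set cnt : BondConfig (Site d) → ℝ := fun ω =>
    (((box d n).filter fun z => ω ∈ (openConn (0 : Site d) z : Set (BondConfig (Site d)))).card : ℝ) with hcnt
  set T : ℝ := S * πn / lam' with hTdef
  have hTpos : 0 < T := div_pos (mul_pos hSpos hπpos) hlam'pos
  -- upper tail by Markov for counts
  have hmarkov : T * ν.real {ω | T ≤ cnt ω} ≤ ∑ z ∈ box d n, ν.real (openConn (0 : Site d) z) :=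
    mul_real_le_card_filter_le_sum ν (box d n) (fun z => (openConn (0 : Site d) z : Set (BondConfig (Site d))))
      (fun z _ => measurableSet_openConn_holds (0 : Site d) z) T
  have hsum : ∑ z ∈ box d n, ν.real (openConn (0 : Site d) z) ≤ Cup * S * πn := by
    refine (hupper ν hν n hn1).trans ?_
    have h3 : (n : ℝ) ^ d ≤ S := pow_le_pow_left₀ hn0.le (by linarith) d
    rw [mul_assoc, mul_assoc]
    exact mul_le_mul_of_nonneg_left (mul_le_mul_of_nonneg_right h3 hπpos.le) hCup.le
  have hHi : ν.real {ω | T ≤ cnt ω} ≤ c / 4 := by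
    have h1 : ν.real {ω | T ≤ cnt ω} ≤ Cup * S * πn / T := by
      rw [le_div_iff₀ hTpos, mul_comm]
      exact hmarkov.trans hsum
    have h2 : Cup * S * πn / T = Cup * lam' := by
      rw [hTdef]
      field_simp
    rw [h2] at h1
    calc ν.real {ω | T ≤ cnt ω} ≤ Cup * lam' := h1
      _ ≤ Cup * (c / (4 * Cup)) := mul_le_mul_of_nonneg_left hlam'le' hCup.le
      _ = c / 4 := by field_simp
  -- lower tail and assembly
  have hLo : c ≤ ν.real {ω | lam * S * πn ≤ cnt ω} := hvol n hn
  have hsplit : ν.real {ω | lam * S * πn ≤ cnt ω} ≤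
      ν.real {ω | lam' * S * πn ≤ cnt ω ∧ cnt ω ≤ S * πn / lam'} + ν.real {ω | T ≤ cnt ω} := by
    refine le_trans (measureReal_mono fun ω hω => ?_) (measureReal_union_le _ _)
    rw [Set.mem_setOf_eq] at hω
    by_cases hhi : cnt ω ≤ S * πn / lam'
    · left
      refine ⟨le_trans ?_ hω, hhi⟩
      exact mul_le_mul_of_nonneg_right (mul_le_mul_of_nonneg_right hlam'le hSpos.le) hπpos.le
    · right
      rw [Set.mem_setOf_eq]
      exact le_of_lt (not_le.1 hhi)
  linarith [hLo, hsplit, hHi]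

open Classical in
/-- **KESTEN'S (8) FROM ANY UNIFORM ANNULUS-BLOCKING BOUND** (`p_c(ℤ^d)`, `d ≥ 2`; (A2)□ at `(s,L)`; `P_{p_c}(Λ(n) ↔ ∂ⁱⁿΛ(Cn)) ≤ 1 − δ`
for all `n ≥ 1` at ONE aspect `C ≥ 2` — the weakest RSW-type UPPER bound): an IIC measure `ν` exists and `λ, c, C' > 0` with, for all
`n ≥ C`, `c ≤ ν{λ(2n+1)^dπ(n) ≤ |C(0) ∩ Λ(n)|}` and `c(2n+1)^dπ(n) ≤ E_ν|C(0) ∩ Λ(n)| ≤ C' n^dπ(n)`.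
[cite: Kesten1986, Thm. (8)] [cite: Aizenman1997, §3 eq. (3.1)] -/
theorem exists_iicMeasure_volume_of_boxCrossing_le (hd : 2 ≤ d) {s L : ℕ} (hs : 2 ≤ s) (hsL : s ≤ L) {ϰ : ℝ} (hϰ : 0 < ϰ)
    (h : SetToSetQuasiMultAspectAt d (criticalProbI d) s L ϰ) {C₀ : ℕ} (hC₀ : 2 ≤ C₀) {δ : ℝ} (hδ : 0 < δ)
    (hblock : ∀ n : ℕ, 1 ≤ n → (bondPercolation (zdGraph d) (criticalProbI d)).real (boxCrossing d n (C₀ * n)) ≤ 1 - δ) :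
    ∃ ν : Measure (BondConfig (Site d)), IsProbabilityMeasure ν ∧
      (∀ (K : Finset (Sym2 (Site d))) (E : Set (BondConfig (Site d))), MeasurableSet E → DeterminedBy E ↑K →
        Tendsto (fun n : ℕ => (bondPercolation (zdGraph d) (criticalProbI d)).real (E ∩ siteToBoundary d n) /
          oneArmProb d (criticalProbI d) n) atTop (𝓝 (ν.real E))) ∧
      ∃ lam c C : ℝ, 0 < lam ∧ 0 < c ∧ 0 < C ∧ ∀ n : ℕ, C₀ ≤ n →
        c ≤ ν.real {ω : BondConfig (Site d) | lam * (2 * (n : ℝ) + 1) ^ d * oneArmProb d (criticalProbI d) n ≤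
          (((box d n).filter fun z => ω ∈ (openConn (0 : Site d) z : Set (BondConfig (Site d)))).card : ℝ)} ∧
        c * (2 * (n : ℝ) + 1) ^ d * oneArmProb d (criticalProbI d) n ≤ ∑ z ∈ box d n, ν.real (openConn (0 : Site d) z) ∧
        ∑ z ∈ box d n, ν.real (openConn (0 : Site d) z) ≤ C * (n : ℝ) ^ d * oneArmProb d (criticalProbI d) n :=
  exists_iicMeasure_sum_openConn_two_sided hd hs hsL hϰ h hC₀
    (annulusClusterCount_tight_of_boxCrossing_le (criticalProbI d) (by omega) hδ hblock)

/-! ## The `ℤ³` instances -/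

open Classical in
/-- **`ℤ³`: (A2)□ + `AnnulusClusterCountTight` ⇒ Kesten's (8), two-sided, for the IIC of `ℤ³`.**
[cite: Kesten1986, Thm. (8)] [cite: BorgsChayesKestenSpencer1999, §1 (tightness postulate)] -/
theorem exists_iicMeasure_volume_Z3_of_annulusClusterCountTight {s L : ℕ} (hs : 2 ≤ s) (hsL : s ≤ L) {ϰ : ℝ} (hϰ : 0 < ϰ)
    (h : SetToSetQuasiMultAspectAt 3 (criticalProbI 3) s L ϰ) (hT : AnnulusClusterCountTight) :
    ∃ ν : Measure (BondConfig (Site 3)), IsProbabilityMeasure ν ∧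
      (∀ (K : Finset (Sym2 (Site 3))) (E : Set (BondConfig (Site 3))), MeasurableSet E → DeterminedBy E ↑K →
        Tendsto (fun n : ℕ => (bondPercolation (zdGraph 3) (criticalProbI 3)).real (E ∩ siteToBoundary 3 n) /
          oneArmProb 3 (criticalProbI 3) n) atTop (𝓝 (ν.real E))) ∧
      ∃ lam c C : ℝ, 0 < lam ∧ 0 < c ∧ 0 < C ∧ ∀ n : ℕ, 2 ≤ n →
        c ≤ ν.real {ω : BondConfig (Site 3) | lam * (2 * (n : ℝ) + 1) ^ 3 * oneArmProb 3 (criticalProbI 3) n ≤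
          (((box 3 n).filter fun z => ω ∈ (openConn (0 : Site 3) z : Set (BondConfig (Site 3)))).card : ℝ)} ∧
        c * (2 * (n : ℝ) + 1) ^ 3 * oneArmProb 3 (criticalProbI 3) n ≤ ∑ z ∈ box 3 n, ν.real (openConn (0 : Site 3) z) ∧
        ∑ z ∈ box 3 n, ν.real (openConn (0 : Site 3) z) ≤ C * (n : ℝ) ^ 3 * oneArmProb 3 (criticalProbI 3) n :=
  exists_iicMeasure_sum_openConn_two_sided (d := 3) (by norm_num) hs hsL hϰ h (C₀ := 2) le_rfl hT

open Classical in
/-- **`ℤ³`: (A2)□ + X_B ⇒ Kesten's (8), two-sided, for the IIC of `ℤ³`** (X_B = `PercAnnulusCrossing.CritAnnulusNonCrossing`, stmt-0846, via the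
lead's `annulusClusterCountTight_of_critAnnulusNonCrossing`). [cite: Kesten1986, Thm. (8)] [cite: Aizenman1997, §3 eq. (3.1)] -/
theorem exists_iicMeasure_volume_Z3_of_critAnnulusNonCrossing {s L : ℕ} (hs : 2 ≤ s) (hsL : s ≤ L) {ϰ : ℝ} (hϰ : 0 < ϰ)
    (h : SetToSetQuasiMultAspectAt 3 (criticalProbI 3) s L ϰ) (hX : Theses.PercAnnulusCrossing.CritAnnulusNonCrossing) :
    ∃ ν : Measure (BondConfig (Site 3)), IsProbabilityMeasure ν ∧
      (∀ (K : Finset (Sym2 (Site 3))) (E : Set (BondConfig (Site 3))), MeasurableSet E → DeterminedBy E ↑K →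
        Tendsto (fun n : ℕ => (bondPercolation (zdGraph 3) (criticalProbI 3)).real (E ∩ siteToBoundary 3 n) /
          oneArmProb 3 (criticalProbI 3) n) atTop (𝓝 (ν.real E))) ∧
      ∃ lam c C : ℝ, 0 < lam ∧ 0 < c ∧ 0 < C ∧ ∀ n : ℕ, 2 ≤ n →
        c ≤ ν.real {ω : BondConfig (Site 3) | lam * (2 * (n : ℝ) + 1) ^ 3 * oneArmProb 3 (criticalProbI 3) n ≤
          (((box 3 n).filter fun z => ω ∈ (openConn (0 : Site 3) z : Set (BondConfig (Site 3)))).card : ℝ)} ∧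
        c * (2 * (n : ℝ) + 1) ^ 3 * oneArmProb 3 (criticalProbI 3) n ≤ ∑ z ∈ box 3 n, ν.real (openConn (0 : Site 3) z) ∧
        ∑ z ∈ box 3 n, ν.real (openConn (0 : Site 3) z) ≤ C * (n : ℝ) ^ 3 * oneArmProb 3 (criticalProbI 3) n :=
  exists_iicMeasure_volume_Z3_of_annulusClusterCountTight hs hsL hϰ h (annulusClusterCountTight_of_critAnnulusNonCrossing hX)

/-! ## Planar Kesten (8) with the lower tail, unconditionally -/

open Classical in
/-- **KESTEN'S THEOREM (8) ON `ℤ²` WITH THE LOWER TAIL — UNCONDITIONAL**: there is a probability measure `ν` with Kesten's IIC limit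
property at `p_c(ℤ²) = 1/2` and `λ, c, C > 0` such that for all `n ≥ 2`: `c ≤ ν{λ(2n+1)²π(n) ≤ |C(0) ∩ Λ(n)|}`,
`c(2n+1)²π_{p_c}(n) ≤ E_ν|C(0) ∩ Λ(n)| ≤ C n² π_{p_c}(n)` — the gen-20 chain with the planar (A2)□ (p1 gen 6, aspect `(9,77)`, RSW) and
`annulusClusterCount_tight_Z2`. [cite: Kesten1986, Thm. (8)] -/
theorem exists_iicMeasure_volume_Z2 :
    ∃ ν : Measure (BondConfig (Site 2)), IsProbabilityMeasure ν ∧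
      (∀ (K : Finset (Sym2 (Site 2))) (E : Set (BondConfig (Site 2))), MeasurableSet E → DeterminedBy E ↑K →
        Tendsto (fun n : ℕ => (bondPercolation (zdGraph 2) (criticalProbI 2)).real (E ∩ siteToBoundary 2 n) /
          oneArmProb 2 (criticalProbI 2) n) atTop (𝓝 (ν.real E))) ∧
      ∃ lam c C : ℝ, 0 < lam ∧ 0 < c ∧ 0 < C ∧ ∀ n : ℕ, 2 ≤ n →
        c ≤ ν.real {ω : BondConfig (Site 2) | lam * (2 * (n : ℝ) + 1) ^ 2 * oneArmProb 2 (criticalProbI 2) n ≤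
          (((box 2 n).filter fun z => ω ∈ (openConn (0 : Site 2) z : Set (BondConfig (Site 2)))).card : ℝ)} ∧
        c * (2 * (n : ℝ) + 1) ^ 2 * oneArmProb 2 (criticalProbI 2) n ≤ ∑ z ∈ box 2 n, ν.real (openConn (0 : Site 2) z) ∧
        ∑ z ∈ box 2 n, ν.real (openConn (0 : Site 2) z) ≤ C * (n : ℝ) ^ 2 * oneArmProb 2 (criticalProbI 2) n := by
  obtain ⟨ϰ, hϰ, hA2⟩ := exists_setToSetQuasiMultAspectAt_two_of_criticalProbI_le
  exact exists_iicMeasure_sum_openConn_two_sided (d := 2) le_rfl (by norm_num) (by norm_num) hϰ (hA2 _ le_rfl) (C₀ := 2) le_rfl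
    annulusClusterCount_tight_Z2

end Rsw3

end Summit.CriticalPhenomena.PercolationContinuityZ3.Theorems
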